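import Summits.NavierStokesRegularity.NavierStokesRegularity.Theorems.ScenarioCensusRowA5FsStatements
import Summits.NavierStokesRegularity.NavierStokesRegularity.Theorems.ScenarioCensusRowF5lgSlice
import HarnessLib

/-!
# Census rows A5fe / A5fi (ns-idea-4 LINE «one-cycle» = the Feller–swirl dictionary) — part 3/7: §2b slice calculus off the axis (`SliceCalc`), §3 the S1 statement `BoxComparison`, §4 the S2/S3 statements `CoreLeak` / `FarTransport`

Part 3 of 7 of the port of `OneCycle_v2_3.lean` (sha16 f100b791173babd1); see `ScenarioCensusRowA5FsBox.lean` for the port note.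
No census value is asserted here; Row_A5 and NS regularity are NOT proved; no summit statement is proved by this file.
-/

noncomputable section
set_option linter.dupNamespace false

open MeasureTheory Set Function Filter Topology InnerProductSpace
open scoped Laplacian RealInnerProductSpace ContDiff ENNReal

namespace Summit.NavierStokesRegularity.NavierStokesRegularity.Theorems.ScenarioCensus.FellerSwirl

open Literature.Analysis.FluidPDE
open Summit.NavierStokesRegularity.NavierStokesRegularity.Theorems.ScenarioCensus (Row_A5 Row_A5fe Row_A5fi row_A5fi_of_row_A5fe)

/-! ## §2b  Slice calculus off the axis (PROVED; adapted from LINE «kappa-inflow» v1.8 §SliceCalc, ns-idea-4 g9-2, with the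
interval `(0,2)` replaced by `(0,∞)`) and THE OPERATOR IDENTITY OF THE DICTIONARY: for a radial `W = φ ∘ cylRadius` and any
vector `v`, `ΔW − DW[v + (2/r)e_r] = φ″(r) + ((m − 1)/r) φ′(r)` with `m = −(x₀v₀ + x₁v₁)`. -/

namespace SliceCalc

open InnerProductSpace
open scoped Laplacian

/-- The horizontal form `ℓ_z = Dρ(z)`: `ℓ_z h = 2(z₀h₀ + z₁h₁)`. -/
def hform (z : E3) : E3 →L[ℝ] ℝ :=
  (2 * z 0) • (EuclideanSpace.proj (0 : Fin 3) : E3 →L[ℝ] ℝ) +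
    (2 * z 1) • (EuclideanSpace.proj (1 : Fin 3) : E3 →L[ℝ] ℝ)

/-- (slice calculus) `hform_apply` — auxiliary step of the Feller–swirl one-cycle argument; see the section docstring above. [new] -/
theorem hform_apply (z h : E3) : hform z h = 2 * (z 0 * h 0 + z 1 * h 1) := by
  simp only [hform, _root_.add_apply, _root_.smul_apply,
    smul_eq_mul, PiLp.proj_apply]
  ring

/-- (slice calculus) `hform_comm` — auxiliary step of the Feller–swirl one-cycle argument; see the section docstring above. [new] -/
theorem hform_comm (z h : E3) : hform z h = hform h z := by
  rw [hform_apply, hform_apply]; ring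

/-- `ℓ_z` as a function of `z` is the continuous linear map `z ↦ ℓ_z`; we only need its differentiability. -/
theorem hasFDerivAt_hform_apply (a z : E3) : HasFDerivAt (fun w : E3 => hform w a) (hform a) z := by
  have : (fun w : E3 => hform w a) = fun w => hform a w := funext fun w => hform_comm w a
  rw [this]
  exact (hform a).hasFDerivAt

/-- (slice calculus) `hasFDerivAt_cylSq` — auxiliary step of the Feller–swirl one-cycle argument; see the section docstring above. [new] -/
theorem hasFDerivAt_cylSq (z : E3) : HasFDerivAt (fun y : E3 => cylRadius y ^ 2) (hform z) z :=
  hasFDerivAt_cylRadius_sq z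

/-- Chain rule: `D(g ∘ ρ)(z) = g'(ρ z) ℓ_z`. -/
theorem hasFDerivAt_comp_cylSq {g : ℝ → ℝ} {g₁ : ℝ} {z : E3} (hg : HasDerivAt g g₁ (cylRadius z ^ 2)) :
    HasFDerivAt (fun w : E3 => g (cylRadius w ^ 2)) (g₁ • hform z) z :=
  hg.comp_hasFDerivAt z (hasFDerivAt_cylSq z)

/-- (slice calculus) `fderiv_comp_cylSq_apply` — auxiliary step of the Feller–swirl one-cycle argument; see the section docstring above. [new] -/
theorem fderiv_comp_cylSq_apply {g : ℝ → ℝ} {g₁ : ℝ} {z : E3} (hg : HasDerivAt g g₁ (cylRadius z ^ 2)) (a : E3) :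
    fderiv ℝ (fun w : E3 => g (cylRadius w ^ 2)) z a = g₁ * hform z a := by
  rw [(hasFDerivAt_comp_cylSq hg).fderiv]; simp

/-- Second directional derivatives: `w ↦ ∂ₐ(g∘ρ)(w)` has derivative `(g''·ℓ_z a) ℓ_z + g'(ρ z) ℓ_a` at `z`. -/
theorem hasFDerivAt_fderiv_comp_cylSq_apply {g g₁ : ℝ → ℝ} {g₂ : ℝ} {U : Set ℝ} (hU : IsOpen U)
    (hg : ∀ σ ∈ U, HasDerivAt g (g₁ σ) σ) {z : E3} (hz : cylRadius z ^ 2 ∈ U)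
    (hg₁ : HasDerivAt g₁ g₂ (cylRadius z ^ 2)) (a : E3) :
    HasFDerivAt (fun w : E3 => fderiv ℝ (fun w : E3 => g (cylRadius w ^ 2)) w a)
      ((g₂ * hform z a) • hform z + (g₁ (cylRadius z ^ 2)) • hform a) z := by
  have heq : (fun w : E3 => g₁ (cylRadius w ^ 2) * hform a w) =ᶠ[𝓝 z]
      fun w => fderiv ℝ (fun w : E3 => g (cylRadius w ^ 2)) w a := by
    filter_upwards [LogGate.SliceCalc.cylSq_preimage_mem_nhds hU hz] with w hw
    rw [fderiv_comp_cylSq_apply (hg _ hw) a, hform_comm]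
  refine HasFDerivAt.congr_of_eventuallyEq ?_ heq.symm
  have h1 : HasFDerivAt (fun w : E3 => g₁ (cylRadius w ^ 2)) (g₂ • hform z) z := hasFDerivAt_comp_cylSq hg₁
  have h2 : HasFDerivAt (fun w : E3 => hform a w) (hform a) z := (hform a).hasFDerivAt
  refine (h1.mul h2).congr_fderiv ?_
  ext v
  simp only [_root_.add_apply, _root_.smul_apply, smul_eq_mul,
    hform_comm a z]
  ring

/-- (slice calculus) `fderiv_fderiv_comp_cylSq_apply` — auxiliary step of the Feller–swirl one-cycle argument; see the section docstring above. [new] -/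
theorem fderiv_fderiv_comp_cylSq_apply {g g₁ : ℝ → ℝ} {g₂ : ℝ} {U : Set ℝ} (hU : IsOpen U)
    (hg : ∀ σ ∈ U, HasDerivAt g (g₁ σ) σ) {z : E3} (hz : cylRadius z ^ 2 ∈ U)
    (hg₁ : HasDerivAt g₁ g₂ (cylRadius z ^ 2)) (a c : E3) :
    fderiv ℝ (fun w : E3 => fderiv ℝ (fun w : E3 => g (cylRadius w ^ 2)) w a) z c =
      g₂ * hform z a * hform z c + g₁ (cylRadius z ^ 2) * hform a c := by
  rw [(hasFDerivAt_fderiv_comp_cylSq_apply hU hg hz hg₁ a).fderiv]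
  simp only [_root_.add_apply, _root_.smul_apply, smul_eq_mul]

/-- Pointwise first and second derivatives of a function `C²` on `(0,2)`. -/
theorem slice_derivs {φ : ℝ → ℝ} (hφ : ContDiffOn ℝ 2 φ (Ioi 0)) {r : ℝ} (hr : r ∈ Ioi (0 : ℝ)) :
    HasDerivAt φ (deriv φ r) r ∧ HasDerivAt (deriv φ) (iteratedDeriv 2 φ r) r := by
  have hO : IsOpen (Ioi (0 : ℝ)) := isOpen_Ioi
  have h := (contDiffOn_succ_iff_deriv_of_isOpen (n := 1) hO).1 (by rw [one_add_one_eq_two]; exact hφ)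
  obtain ⟨hd, _, hd'⟩ := h
  refine ⟨(hd.differentiableAt (hO.mem_nhds hr)).hasDerivAt, ?_⟩
  have hdd : DifferentiableOn ℝ (deriv φ) (Ioi 0) := hd'.differentiableOn one_ne_zero
  have h2 : HasDerivAt (deriv φ) (deriv (deriv φ) r) r :=
    (hdd.differentiableAt (hO.mem_nhds hr)).hasDerivAt
  rwa [show (2 : ℕ) = 1 + 1 from rfl, iteratedDeriv_succ, iteratedDeriv_one]

/-- **Slice calculus of a cylindrical barrier off the axis.** For `φ` of class `C²` on `(0,2)` and a point `z` with
`0 < r = cylRadius z < 2`: the slice `x ↦ φ(cylRadius x)` is `C²` at `z`, its differential is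
`a ↦ φ'(r) r⁻¹ (z₀a₀ + z₁a₁)` (`= φ'(r)⟪e_r, a⟫`), and its Laplacian is `φ''(r) + r⁻¹φ'(r)`. [folklore] -/
theorem barrier_slice_calculus {φ : ℝ → ℝ} (hφ : ContDiffOn ℝ 2 φ (Ioi 0)) {z : E3}
    (hz : 0 < cylRadius z) :
    ContDiffAt ℝ 2 (fun w : E3 => φ (cylRadius w)) z ∧
    (∀ a : E3, fderiv ℝ (fun w : E3 => φ (cylRadius w)) z a =
        deriv φ (cylRadius z) * (cylRadius z)⁻¹ * (z 0 * a 0 + z 1 * a 1)) ∧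
    (Δ (fun w : E3 => φ (cylRadius w))) z =
        iteratedDeriv 2 φ (cylRadius z) + (cylRadius z)⁻¹ * deriv φ (cylRadius z) := by
  set r := cylRadius z with hr
  have hrI : r ∈ Ioi (0 : ℝ) := hz
  -- the slice as `g ∘ ρ`, `g = φ ∘ √`
  set g : ℝ → ℝ := fun s => φ (Real.sqrt s) with hg
  have hfun : (fun w : E3 => φ (cylRadius w)) = fun w => g (cylRadius w ^ 2) := by
    funext w; simp only [hg, Real.sqrt_sq (cylRadius_nonneg w)]
  -- derivatives of `g` on `U = (0,∞)`
  set U : Set ℝ := Ioi 0 with hU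
  have hUo : IsOpen U := isOpen_Ioi
  have hsqU : ∀ σ ∈ U, Real.sqrt σ ∈ Ioi (0 : ℝ) := fun σ hσ => Real.sqrt_pos.2 hσ
  set g₁ : ℝ → ℝ := fun σ => deriv φ (Real.sqrt σ) / (2 * Real.sqrt σ) with hg₁
  have hgd : ∀ σ ∈ U, HasDerivAt g (g₁ σ) σ := fun σ hσ => by
    have h1 := (slice_derivs hφ (hsqU σ hσ)).1
    have h2 := Real.hasDerivAt_sqrt (ne_of_gt hσ)
    refine (h1.comp σ h2).congr_deriv ?_
    rw [hg₁]
    ring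
  have hzU : cylRadius z ^ 2 ∈ U := by
    show 0 < cylRadius z ^ 2
    positivity
  have hsr : Real.sqrt (r ^ 2) = r := Real.sqrt_sq hz.le
  have hg₁d : HasDerivAt g₁
      ((iteratedDeriv 2 φ r * (1 / (2 * r)) * (2 * r) - deriv φ r * (2 * (1 / (2 * r)))) / (2 * r) ^ 2)
      (cylRadius z ^ 2) := by
    rw [← hr]
    have hσ0 : (r ^ 2 : ℝ) ≠ 0 := by positivity
    have hs := Real.hasDerivAt_sqrt hσ0
    rw [hsr] at hs
    have d1 : HasDerivAt (fun σ => deriv φ (Real.sqrt σ)) (iteratedDeriv 2 φ r * (1 / (2 * r))) (r ^ 2) := by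
      have h := (slice_derivs hφ hrI).2
      have h' : HasDerivAt (deriv φ) (iteratedDeriv 2 φ r) (Real.sqrt (r ^ 2)) := by rwa [hsr]
      exact h'.comp (r ^ 2) hs
    have d2 : HasDerivAt (fun σ => 2 * Real.sqrt σ) (2 * (1 / (2 * r))) (r ^ 2) := hs.const_mul 2
    have hne : (2 * Real.sqrt (r ^ 2)) ≠ 0 := by rw [hsr]; positivity
    refine (d1.div d2 hne).congr_deriv ?_
    rw [hsr]
  refine ⟨?_, fun a => ?_, ?_⟩
  · exact (hφ.contDiffAt (isOpen_Ioi.mem_nhds hrI)).comp z (contDiffAt_cylRadius hz.ne')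
  · rw [hfun, fderiv_comp_cylSq_apply (hgd _ hzU) a, hform_apply, hg₁]
    simp only [← hr, hsr]
    field_simp
  · rw [hfun, LogGate.SliceCalc.laplacian_comp_cylSq hUo hgd hzU hg₁d, hg₁]
    simp only [← hr, hsr]
    field_simp
    ring

end SliceCalc

/-- PROVED. `e_r` components: `(e_r)_0 = x₀/r`, `(e_r)_1 = x₁/r`. -/
theorem eR_apply_01 (x : E3) : eR x 0 = (cylRadius x)⁻¹ * x 0 ∧ eR x 1 = (cylRadius x)⁻¹ * x 1 := by
  constructor <;> simp [eR]

open SliceCalc in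
/-- PROVED (the operator identity of the dictionary). For `φ` of class `C²` on `(0,∞)`, a point `x` off the axis
(`r = cylRadius x > 0`) and ANY vector `v` (the drift value): the swirl operator applied to the radial slice
`W = φ ∘ cylRadius` is `ΔW(x) − DW(x)[v + (2/r)e_r(x)] = φ″(r) + ((m − 1)/r) φ′(r)`, `m := −(x₀v₀ + x₁v₁)` the inflow
number of `v` at `x`. (So the radial part of the backward meridional generator is that of a Bessel process of dimension `m`.) -/
theorem radial_operator {φ : ℝ → ℝ} (hφ : ContDiffOn ℝ 2 φ (Ioi 0)) {x : E3} (hx : 0 < cylRadius x) (v : E3) :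
    (Δ (fun w : E3 => φ (cylRadius w))) x
        - fderiv ℝ (fun w : E3 => φ (cylRadius w)) x (v + (2 / cylRadius x) • eR x)
      = iteratedDeriv 2 φ (cylRadius x)
        + (-(x 0 * v 0 + x 1 * v 1) - 1) / cylRadius x * deriv φ (cylRadius x) := by
  obtain ⟨_, hD, hΔ⟩ := barrier_slice_calculus hφ hx
  obtain ⟨e0, e1⟩ := eR_apply_01 x
  have hr0 : cylRadius x ≠ 0 := hx.ne'
  have hsum : x 0 * (v + (2 / cylRadius x) • eR x) 0 + x 1 * (v + (2 / cylRadius x) • eR x) 1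
      = (x 0 * v 0 + x 1 * v 1) + 2 := by
    simp only [PiLp.add_apply, PiLp.smul_apply, smul_eq_mul, e0, e1]
    have h2 : x 0 * x 0 + x 1 * x 1 = cylRadius x * cylRadius x := by
      have := cylRadius_sq x; nlinarith [this]
    field_simp
    nlinarith [h2]
  rw [hΔ, hD, hsum]
  field_simp
  ring

/-! ## §3  S1 — the comparison tool: time-integrated solutions vs. a classical super-solution on `[t_b,t_T] × D`,
`D` compact inside the open set `U` of the local class (Lieberman 1996 Ch. II Cor. 2.5; the tree's
`IsDriftHeatSolutionOn.paraboloid_comparison` with the paraboloid replaced by a cylinder over a compact set and the robust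
inequality `φₜ ≤ Δφ − A‖∇φ‖` replaced by the pointwise one against the actual drift) -/

/-- **S1 `BoxComparison` (support, provable now, S–M).** Let `g ∈ IsDriftHeatSolutionOn a g A S U` (`U` open,
`[t_b, t_T] ⊆ S`), `D ⊆ U` compact, and `φ` a classical super-solution on the interior of `D`:
`φ` jointly continuous on `[t_b,t_T] × U`, `C²` slices on `U`, a classical time derivative `φₜ` with `φₜ`, `∇φ`, `Δφ`
continuous in `t`, and `Δφ − Dφ[a(t,x)] ≤ φₜ` at the points of `(t_b, t_T] × interior D`. If `g ≤ φ` on the bottom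
`{t_b} × D` and on `[t_b,t_T] × (D ∖ interior D)`, then `g ≤ φ` on `[t_b, t_T] × D`. Proof = the tree's
`IsDriftHeatSolutionOn.paraboloid_comparison` (DriftHeatLocalComparison.lean:104) verbatim with the compact region
`[t_b,t_T] × D`, joint continuity of `g` from `IsDriftHeatSolutionOn.continuousOn_uncurry`, the second-order condition from
`laplacian_nonpos_of_isLocalMax_of_contDiffOn`. -/
def BoxComparison : Prop :=
  ∀ ⦃a : ℝ → E3 → E3⦄ ⦃g : ℝ → E3 → ℝ⦄ ⦃A : ℝ⦄ ⦃S : Set ℝ⦄ ⦃U D : Set E3⦄ ⦃t_b t_T : ℝ⦄ ⦃φ φt : ℝ → E3 → ℝ⦄,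
    IsDriftHeatSolutionOn a g A S U → IsOpen U → Icc t_b t_T ⊆ S → IsCompact D → D ⊆ U →
    ContinuousOn (uncurry φ) (Icc t_b t_T ×ˢ U) →
    (∀ t ∈ Icc t_b t_T, ContDiffOn ℝ 2 (φ t) U) →
    (∀ x ∈ U, ∀ t ∈ Icc t_b t_T, HasDerivAt (fun τ => φ τ x) (φt t x) t) →
    (∀ x ∈ U, ContinuousOn (fun τ => φt τ x) (Icc t_b t_T)) →
    (∀ x ∈ U, ContinuousOn (fun τ => fderiv ℝ (φ τ) x) (Icc t_b t_T)) →
    (∀ x ∈ U, ContinuousOn (fun τ => (Δ (φ τ)) x) (Icc t_b t_T)) →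
    (∀ t ∈ Ioc t_b t_T, ∀ x ∈ interior D, (Δ (φ t)) x - fderiv ℝ (φ t) x (a t x) ≤ φt t x) →
    (∀ x ∈ D, g t_b x ≤ φ t_b x) →
    (∀ t ∈ Icc t_b t_T, ∀ x ∈ D \ interior D, g t x ≤ φ t x) →
    ∀ t ∈ Icc t_b t_T, ∀ x ∈ D, g t x ≤ φ t x

/-! ## §4  S2 / S3 — the two barrier runs (Step A: core leak; Step B: far transport) -/

/-- **S2 `CoreLeak` (support, provable now given S1, M).** THE CORE LEAKS A FIXED FRACTION: there is `p₀ ∈ (0,1)`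
depending only on `(C_u, R₁)` — explicitly `p₀ = coreLeakFraction C_u R₁ = ψ(R₁)` — such that every swirl pair with
`|f| ≤ F` on `(−∞,0) × ℝ³` satisfies `|f| ≤ (1 − p₀) F` on `{r ≤ R₁}`. NO one-sided hypothesis is used: inside a slab of
bounded radius a bounded drift cannot stop the diffusion from reaching the absorbing axis (dictionary: the worst case is
the Bessel process of dimension `c r`, whose scale function is `ψ`). Proof plan (S1 twice, for `±f`): on
`D = {a ≤ r ≤ L, |z − z*| ≤ Z} × [t* − T, t*]` (`L = R₁ + 1`, `c = |C_u| + 1`) compare with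
`η + F(1 − ψ(r)) + F e^{−μ(t−t_b)} Φ(r) + F e^{ν(t−t_b)} cosh(z − z*)/cosh Z` (`coreProfile_subsolution`,
`initialCorrector_ineq` with `K = |C_u| + 1/a`, `lateralCorrector_ineq` with `β = 1`, `ν = 1 + |C_u|`; faces: `r = a` by
`|f| ≤ C_g a ≤ η`, `r = L` by `ψ(L) = 0`, `|z − z*| = Z` and `t = t_b` by the correctors); then `Z → ∞`, `T → ∞`,
`η ↓ C_g a`, `a ↓ 0` at the fixed point `(t*, x*)`. Why it might fail: only bookkeeping (the slice calculus of
`w ∘ cylRadius` off the axis, as in KappaInflow_v1 §SliceCalc, and four explicit limits). -/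
def CoreLeak : Prop :=
  ∀ (Cu R₁ : ℝ), 0 < R₁ → ∃ p₀ : ℝ, 0 < p₀ ∧ p₀ < 1 ∧
    ∀ (f : ℝ → E3 → ℝ) (u : ℝ → E3 → E3) (Cg F : ℝ), IsSwirlPair f u Cg Cu →
      (∀ t < 0, ∀ x, |f t x| ≤ F) →
        ∀ t < 0, ∀ x, cylRadius x ≤ R₁ → |f t x| ≤ (1 - p₀) * F

/-- **S3 `FarTransport` (support, provable now given S1, M).** THE FAR FIELD CANNOT EXCEED THE CORE: if the inflow
number is at most `2 − δ` on `{r ≥ R₁}` (`R₁ > 0`), `|f| ≤ F` everywhere and `|f| ≤ F₁` on `{r ≤ R₁}`, then `|f| ≤ F₁`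
everywhere (dictionary: dimension `≤ 2 − δ < 2` at large radii = recurrence; PDE shadow: `r^δ` is a super-solution).
Proof plan (S1 twice): on `D = {R₁ ≤ r ≤ R, |z − z*| ≤ Z} × [t* − T, t*]` compare with
`F₁ + (F − F₁)(r^δ − R₁^δ)/(R^δ − R₁^δ) + F e^{−μ(t−t_b)}Φ(r) + F e^{ν(t−t_b)} cosh(z − z*)/cosh Z`
(`farProfile_supersolution`, `initialCorrector_ineq` with `K = |C_u| + 1/R₁`, `lateralCorrector_ineq`; faces: `r = R₁` by the
core bound, `r = R`, `|z − z*| = Z`, `t = t_b` by `|f| ≤ F`); then `Z → ∞`, `T → ∞`, `R → ∞`. (If `F < F₁` there is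
nothing to prove.) Why it might fail: bookkeeping only; the exponent `δ` is exactly what `m ≤ 2 − δ` affords
(`powerBarrier_fails` of g9-1: at `m > 2 − δ` the profile fails). -/
def FarTransport : Prop :=
  ∀ (f : ℝ → E3 → ℝ) (u : ℝ → E3 → E3) (Cg Cu δ R₁ F F₁ : ℝ), IsSwirlPair f u Cg Cu → 0 < δ → 0 < R₁ →
    (∀ t < 0, ∀ x, R₁ ≤ cylRadius x → -(2 - δ) ≤ x 0 * u t x 0 + x 1 * u t x 1) →
      (∀ t < 0, ∀ x, |f t x| ≤ F) →
        (∀ t < 0, ∀ x, cylRadius x ≤ R₁ → |f t x| ≤ F₁) →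
          ∀ t < 0, ∀ x, |f t x| ≤ F₁


end Summit.NavierStokesRegularity.NavierStokesRegularity.Theorems.ScenarioCensus.FellerSwirl

end
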